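import Literature.NumberTheory.Sieve.Maynard2016Lemma2Proof
import Literature.NumberTheory.Sieve.Maynard2016MainChain
import HarnessLib

/-!
# Maynard 2016: Theorem 1 from the GPY measures alone (Lemmas 2, 3, 4 discharged)

Topic `Literature/NumberTheory/Sieve`. Everything in this file is PROVED (composition). With
`Maynard2016.lemma2_holds : Lemma2` (`Maynard2016Lemma2Proof`, the Maier–Pomerance bound for
shifted smooth numbers) and `Maynard2016.lemma3_holds : Lemma3` (`Maynard2016Lemma3Proof`,
fundamental lemma + Bombieri–Vinogradov) now theorems of the tree, the kernel-checked chain of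
J. Maynard, *Large gaps between primes*, Ann. of Math. 183 (2016) — §2 (`reduction_holds`,
`theorem1_of_coveringTheorem`), §3 (`proposition5Prime_of_GPYMeasures`, `proposition5_of_prime`
with the de la Vallée Poussin prime number theorem), Lemma 4 from Lemma 3 (`lemma4_of_lemma3`) —
leaves exactly ONE named input:

* `Maynard2016.GPYMeasures` (§4 ¶1: the probability measures `μ_{m,q}` delivered by the
  multidimensional sieve weights (4.1) and Lemmas 6.1–6.2 + the integral estimate of §8),

or, one step downstream, `Maynard2016.Proposition5` (equivalently `Proposition5Prime`).
This file records the resulting implications as citable theorems.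

## Main statements

* `lemma4_holds : Lemma4` — Lemma 4 unconditionally.
* `coveringTheorem_of_proposition5`, `theorem1_of_proposition5`, `theorem1_of_proposition5Prime`.
* `theorem1_of_GPYMeasures_holds : GPYMeasures → Maynard2016_theorem1` and
  `forall_rankinConstant_of_GPYMeasures_holds : GPYMeasures → ∀ c, RankinConstant c`
  (Rankin's bound `G(X) ≥ c log X log₂ X log₄ X/(log₃ X)²` with every constant `c`).

## References

* J. Maynard, *Large gaps between primes*, Ann. of Math. (2) 183 (2016), 915–933; arXiv:1408.5110,
  Theorem 1, §§2–4. [Maynard2016LargeGaps]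
* H. Maier, C. Pomerance, *Unusually large gaps between consecutive primes*, Trans. AMS 322
  (1990), Thm 5.3. [MaierPomerance1990]
-/

namespace Literature.NumberTheory.Sieve

namespace Maynard2016

/-- **Maynard 2016, Lemma 4**, unconditionally (Lemma 3 is proved). [cite: Maynard2016LargeGaps, Lemma 4] -/
theorem lemma4_holds : Lemma4 :=
  lemma4_of_lemma3 lemma3_holds

/-- **The covering theorem of §2 from Proposition 5 alone** (Lemmas 2 and 4 discharged).
[cite: Maynard2016LargeGaps, §2 («We now prove Theorem 1 assuming Proposition 5»)] -/
theorem coveringTheorem_of_proposition5 (h₅ : Proposition5) : CoveringTheorem :=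
  reduction_holds lemma2_holds lemma4_holds h₅

/-- **Maynard 2016, Theorem 1 from Proposition 5 alone.** [cite: Maynard2016LargeGaps, Thm 1] -/
theorem theorem1_of_proposition5 (h₅ : Proposition5) :
    Literature.NumberTheory.Sieve.Maynard2016_theorem1 :=
  theorem1_of_lemmas lemma2_holds lemma3_holds h₅

/-- **Maynard 2016, Theorem 1 from Proposition 5′ alone** (§3's equivalent form; the prime
number theorem input of `5′ ⇒ 5` is discharged in `Maynard2016Inputs`).
[cite: Maynard2016LargeGaps, Thm 1; Maynard2016LargeGaps, §3 (first paragraph)] -/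
theorem theorem1_of_proposition5Prime (h₅ : Proposition5Prime) :
    Literature.NumberTheory.Sieve.Maynard2016_theorem1 :=
  theorem1_of_proposition5 (proposition5_of_proposition5Prime h₅ lemma3_holds)

/-- **Maynard 2016, Theorem 1 from the GPY measures of §4 alone**: Lemma 2 (Maier–Pomerance),
Lemma 3, Lemma 4, §§2–3 and the prime number theorem with error term are all theorems of the
tree. [cite: Maynard2016LargeGaps, Thm 1; Maynard2016LargeGaps, §4 (first paragraph)] -/
theorem theorem1_of_GPYMeasures_holds (hμ : GPYMeasures) :
    Literature.NumberTheory.Sieve.Maynard2016_theorem1 :=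
  theorem1_of_lemma2_GPY lemma2_holds hμ

/-- **Every Rankin constant from the GPY measures alone**: for every `c`, prime gaps
`≥ c log X log₂ X log₄ X/(log₃ X)²` below `X` infinitely often. [cite: Maynard2016LargeGaps, Thm 1] -/
theorem forall_rankinConstant_of_GPYMeasures_holds (hμ : GPYMeasures) (c : ℝ) :
    Literature.NumberTheory.Sieve.RankinConstant c :=
  forall_rankinConstant_of_lemma2_GPY lemma2_holds hμ c

/-- **Every Rankin constant from Proposition 5 alone.** [cite: Maynard2016LargeGaps, Thm 1] -/
theorem forall_rankinConstant_of_proposition5 (h₅ : Proposition5) (c : ℝ) :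
    Literature.NumberTheory.Sieve.RankinConstant c :=
  forall_rankinConstant_of_lemmas lemma2_holds lemma3_holds h₅ c

end Maynard2016

end Literature.NumberTheory.Sieve
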